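import Literature.MeasureTheory.Group.InvariantQuotientNormalized
import Literature.MeasureTheory.Group.InvariantQuotientConjugacySumPartial
import HarnessLib

/-!
# The geometric side restricted to a family of conjugacy classes, with the printed constants:
`∫_{G ⧸ L} Σ_{γ ∈ Γ, [γ] ∈ 𝒞} F(x γ x⁻¹) dμ = c_μ Σ_{c ∈ 𝒞} vol(G_c ⧸ H_c) ∫_{G ⧸ G_c} F(y γ_c y⁻¹) d(ν/ν_c)`
(Gelbart, *Automorphic forms on adele groups* (1975), (9.13), Thm. 9.22 (ii), Remark 9.23 and
p. 155: "Tamagawa measures being taken on both sides")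

Topic `MeasureTheory/Group`; theorems only (no definition, no named fact, no instance). The common
refinement of `InvariantQuotientNormalized.lintegral_conjTsum_eq_mul_tsum_covol_mul` (all classes,
printed constants — the compact-quotient situation of a division quaternion algebra) and
`InvariantQuotientConjugacySumPartial.exists_lintegral_conjTsum_mk_mem_eq_tsum` (an arbitrary set
`𝒞` of classes, unspecified constants `d_c ∈ (0, ∞)` — the situation of the elliptic classes of
`GL₂(K)` on the non-compact quotient `GL₂(𝔸) ⧸ A_G GL₂(K)`): **the sum over the classes in `𝒞` with
the printed volumes**, the per-class hypotheses (`H_c = L ∩ C_G(γ_c)` relatively open in `L`,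
`G_c ⊇ H_c` closed centralising `γ_c` with `G_c ⧸ H_c` compact, Haar measures `ν_c` on `G_c`) being
required only for `c ∈ 𝒞`:

* `lintegral_conjTsum_mk_mem_eq_mul_tsum_covol_mul` —
  `∫_{G ⧸ L} Σ'_{γ ∈ Γ, [γ] ∈ 𝒞} F(x γ x⁻¹) dμ(x)
     = c_μ · Σ'_{c ∈ 𝒞} vol(G_c ⧸ H_c) · ∫_{G ⧸ G_c} F(y γ_c y⁻¹) d(ν/ν_c)(y)`
  for Borel `F ≥ 0`, with `c_μ = unfoldingConstant L ρ_L μ ν` (`= 1` for `μ = ν/ρ_L`),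
  `ν/ν_c = quotientMeasure G_c ν_c ν` (Weil constant one) and `vol(G_c ⧸ H_c)` the covolume of `H_c`
  in `G_c` for `ν_c` and `ρ_L|_{H_c}` — Gelbart's `meas(Z_∞⁺ G(γ)_ℚ \ G(γ)_𝔸)` of Thm. 9.22 (ii). This is
  what a term-by-term comparison of the elliptic terms of (10.14) and (10.15) consumes on the `GL₂`
  side. One class at a time by `lintegral_conjTsum_conjOrbit_eq_covol_mul`, summed over `𝒞` by
  `conjTsum_mk_mem_eq_tsum_conjOrbit` and monotone convergence;
* `quotientMeasure_univ_ne_zero_ne_top'` — the covolumes lie in `(0, ∞)` (indexing by `c ∈ 𝒞`).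

## References

* S. Gelbart, *Automorphic forms on adele groups*, Ann. of Math. Studies 83 (1975), (9.13),
  Thm. 9.22 (ii), Remark 9.23, p. 155 [Gelbart1975].
-/

noncomputable section

open _root_.MeasureTheory _root_.MeasureTheory.Measure _root_.Topology Set Filter
open scoped ENNReal NNReal Pointwise

/- Work with Borel structures on the coset spaces, as in `InvariantQuotientConjugacySum`. -/
attribute [-instance] Quotient.instMeasurableSpace QuotientGroup.measurableSpace

namespace Literature.MeasureTheory.Group

section AssemblyNormalizedPartial

variable {G : Type*} [Group G] [TopologicalSpace G] [IsTopologicalGroup G] [LocallyCompactSpace G]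
  [SecondCountableTopology G] [T2Space G] [MeasurableSpace G] [BorelSpace G]
  (Γ L : Subgroup G) [hL : IsClosed (L : Set G)] [Countable Γ] (hΓL : Γ ≤ L)
  (hLΓ : ∀ ℓ ∈ L, ∃ γ ∈ Γ, γ⁻¹ * ℓ ∈ Subgroup.centralizer (Γ : Set G))
  (rep : ConjClasses Γ → Γ) (hrep : ∀ c, ConjClasses.mk (rep c) = c)
  (𝒞 : Set (ConjClasses Γ))
  (Hc Gc : 𝒞 → Subgroup G) [hHcl : ∀ c, IsClosed ((Hc c : Subgroup G) : Set G)]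
  (hHc : ∀ (c : 𝒞) g, g ∈ Hc c ↔ g ∈ L ∧ g * (rep c : G) = (rep c : G) * g)
  (hHG : ∀ c, Hc c ≤ Gc c) (hGc : ∀ (c : 𝒞), ∀ g ∈ Gc c, g * (rep c : G) = (rep c : G) * g)
  [hGcl : ∀ c, IsClosed ((Gc c : Subgroup G) : Set G)]
  [MeasurableSpace (G ⧸ L)] [BorelSpace (G ⧸ L)]
  [∀ c, MeasurableSpace (G ⧸ Gc c)] [∀ c, BorelSpace (G ⧸ Gc c)]
  [∀ c, MeasurableSpace (Gc c ⧸ (Hc c).subgroupOf (Gc c))]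
  [∀ c, BorelSpace (Gc c ⧸ (Hc c).subgroupOf (Gc c))]
  (μ : Measure (G ⧸ L)) [SMulInvariantMeasure G (G ⧸ L) μ] [IsFiniteMeasureOnCompacts μ]
  (ν : Measure G) [IsHaarMeasure ν] [ν.IsMulRightInvariant]
  (ρL : Measure L) [IsHaarMeasure ρL] [SFinite ρL]
  (ρH : ∀ c, Measure (Hc c)) [∀ c, IsHaarMeasure (ρH c)] [∀ c, (ρH c).IsInvInvariant]
  [∀ c, SFinite (ρH c)]
  (ρF : ∀ c, Measure ((Hc c).subgroupOf (Gc c))) [∀ c, IsHaarMeasure (ρF c)]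
  [∀ c, (ρF c).IsInvInvariant] [∀ c, SFinite (ρF c)]
  (νC : ∀ c, Measure (Gc c)) [∀ c, IsHaarMeasure (νC c)] [∀ c, (νC c).IsMulRightInvariant]
  [∀ c, (νC c).IsInvInvariant] [∀ c, SFinite (νC c)]

omit hL [Countable Γ]
  [MeasurableSpace (G ⧸ L)] [BorelSpace (G ⧸ L)] [∀ c, MeasurableSpace (G ⧸ Gc c)]
  [∀ c, BorelSpace (G ⧸ Gc c)] [∀ c, SFinite (ρF c)]
  [∀ c, (νC c).IsInvInvariant] [∀ c, SFinite (νC c)] in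
/-- **The covolumes are positive and finite** (indexing by the classes of `𝒞`): the total mass
`vol(G_c ⧸ H_c)` of the compact coset space `G_c ⧸ H_c` for the quotient measure lies in `(0, ∞)`.
[folklore] -/
theorem quotientMeasure_univ_ne_zero_ne_top'
    [∀ c, CompactSpace (Gc c ⧸ (Hc c).subgroupOf (Gc c))] (c : 𝒞) :
    quotientMeasure ((Hc c).subgroupOf (Gc c)) (ρF c) (isClosed_subgroupOf _ _ (hHcl c)) (νC c)
        Set.univ ≠ 0 ∧
      quotientMeasure ((Hc c).subgroupOf (Gc c)) (ρF c) (isClosed_subgroupOf _ _ (hHcl c)) (νC c)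
        Set.univ ≠ ∞ :=
  ⟨Measure.measure_univ_ne_zero.2 (quotientMeasure_ne_zero _ (ρF c) _ (νC c)),
    (isCompact_univ.measure_lt_top (μ := quotientMeasure ((Hc c).subgroupOf (Gc c)) (ρF c)
      (isClosed_subgroupOf _ _ (hHcl c)) (νC c))).ne⟩

include hΓL hrep hHc in
/-- **The geometric side restricted to a family `𝒞` of conjugacy classes, with the printed
constants** (Gelbart (1975), (9.13) and Thm. 9.22 (ii): the elliptic terms
`Σ_{γ ∈ {G_e}} meas(Z_∞⁺ G(γ)_ℚ \ G(γ)_𝔸) ∫_{G(γ)_𝔸 \ G_𝔸} f(x⁻¹ γ x) dx`). Setting: `G` locally compact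
second countable Hausdorff, `Γ ≤ L ≤ G` with `L` closed, `Γ` countable and `L = Γ · C_L(Γ)`, `𝒞` a
set of conjugacy classes of `Γ`; for each `c ∈ 𝒞` a representative `γ_c = rep c`, the closed
subgroup `H_c = L ∩ C_G(γ_c)` (relatively open in `L`), a closed subgroup `G_c ⊇ H_c` centralising
`γ_c` with `G_c ⧸ H_c` compact; a `G`-invariant Borel measure `μ ≠ 0` on `G ⧸ L` finite on compact
sets; Haar measures `ν` on `G` (two-sided), `ρ_L` on `L`, `ν_c` on `G_c` (two-sided, inversion
invariant); `ρ_{H,c} = ρ_L ∘ ι` the restriction of `ρ_L` to `H_c` and `ρ_{F,c}` its transport to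
`H_c ≤ G_c`. Then for every Borel `F : G → [0, ∞]`

  `∫_{G ⧸ L} Σ'_{γ ∈ Γ, [γ] ∈ 𝒞} F(x γ x⁻¹) dμ(x)
     = c_μ · Σ'_{c ∈ 𝒞} vol(G_c ⧸ H_c) · ∫_{G ⧸ G_c} F(y γ_c y⁻¹) d(ν/ν_c)(y)`,

`c_μ = unfoldingConstant L ρ_L μ ν` (`= 1` for `μ = ν/ρ_L`), `ν/ν_c = quotientMeasure G_c ν_c ν`,
`vol(G_c ⧸ H_c) = quotientMeasure (H_c ⊓ G_c) ρ_{F,c} ν_c (⊤)`; nothing is assumed about the classes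
outside `𝒞`. [cite: Gelbart1975, (9.13) and Thm. 9.22 (ii)] -/
theorem lintegral_conjTsum_mk_mem_eq_mul_tsum_covol_mul
    (hopen : ∀ c, IsOpen (((Hc c).subgroupOf L : Subgroup L) : Set L))
    [∀ c, CompactSpace (Gc c ⧸ (Hc c).subgroupOf (Gc c))] (hμ : μ ≠ 0)
    (hρH : ∀ c, ρH c = ρL.comap (Subgroup.inclusion (le_of_mem_iff L (Hc c) (hHc c))))
    (hρF : ∀ c, ρF c = Measure.map (Subgroup.subgroupOfEquivOfLe (hHG c)).symm (ρH c))
    {F : G → ℝ≥0∞} (hF : Measurable F) :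
    ∫⁻ x, conjTsum L (((↑) : Γ → G) '' {γ : Γ | ConjClasses.mk γ ∈ 𝒞})
        (conj_mem_of_mk_mem Γ 𝒞 L hLΓ) F x ∂μ =
      unfoldingConstant L ρL μ ν * ∑' c : 𝒞,
        quotientMeasure ((Hc c).subgroupOf (Gc c)) (ρF c) (isClosed_subgroupOf _ _ (hHcl c))
            (νC c) Set.univ *
          ∫⁻ y, descConj (rep c : G) (Gc c) (hGc c) F y
            ∂quotientMeasure (Gc c) (νC c) (hGcl c) ν := by
  have key := fun c : 𝒞 => lintegral_conjTsum_conjOrbit_eq_covol_mul Γ L hΓL hLΓ (rep c).2 (Hc c)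
    (Gc c) (hHc c) (hHG c) (hGc c) μ ν ρL (ρH c) (ρF c) (νC c) (hopen c) hμ (hρH c) (hρF c) hF
  have h1 : ∀ x, conjTsum L (((↑) : Γ → G) '' {γ : Γ | ConjClasses.mk γ ∈ 𝒞})
      (conj_mem_of_mk_mem Γ 𝒞 L hLΓ) F x =
      ∑' c : 𝒞, conjTsum L (conjOrbit Γ (rep c : G))
        (conj_mem_conjOrbit_of_exists Γ L hLΓ (rep c).2) F x :=
    conjTsum_mk_mem_eq_tsum_conjOrbit Γ 𝒞 L hLΓ rep hrep F
  haveI := countable_conjClasses Γ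
  simp_rw [h1]
  rw [lintegral_tsum fun c => ?_, ← ENNReal.tsum_mul_left]
  · exact tsum_congr fun c => by rw [key c, mul_assoc]
  · haveI := countable_conjOrbit Γ (rep c : G)
    exact (measurable_conjTsum L _ _ hL hF).aemeasurable

end AssemblyNormalizedPartial

end Literature.MeasureTheory.Group
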